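import Literature.NumberTheory.Automorphic.CuspidalCohomologyGL
import HarnessLib

/-!
# The untwisted function model `Fun(𝒢 ⧸ L, M)` is the twisted model with trivial twist

Topic `NumberTheory/Automorphic`; namespace `Literature.NumberTheory.Automorphic`, grouping
sub-namespace `ArithmeticQuotient`.  One auxiliary definition with body and theorems; no named
fact.

The tree has two function models of the coefficients of the arithmetic quotients `X_L`:
`ArithmeticQuotient.coeffRep k ι L M` (`(γ f)(c) = f(ι(γ)⁻¹ c)`, used by completed cohomology and,
through `BigHeckeGLn.coeffRepIso` / `BigHeckeGLn.levelCohomologyIso` of `CompletedCohomologyGL`,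
by the big Hecke algebra `𝕋(𝒰)`) and `TwistedQuotient.coeffRep ι L ρ`
(`(γ f)(c) = ρ(γ) f(ι(γ)⁻¹ c)`, used by the cuspidal / Eisenstein cohomology files and by the
level-change package `TwistedQuotientLevelChange`).  For the trivial twist `ρ = 1` they are the
same representation (`coeffRepresentation_eq_twisted`); we record the identity isomorphism
`coeffRepIsoTwisted : ArithmeticQuotient.coeffRep k ι L M ≅ TwistedQuotient.coeffRep ι L 1` and
that it intertwines the Hecke operators `[L g L]` on coefficients
(`heckeRepHom_comp_coeffRepIsoTwisted`, both are `ArithmeticQuotient.heckeFun`) and on cohomology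
(`map_coeffRepIsoTwisted_heckeEnd`), so that results proved in either model (e.g. the
Hochschild–Serre level reduction of [Scholze2015, §V.4, proof of Thm. V.4.1] in the twisted model)
apply to the other.

## References

* P. Scholze, *On torsion in the cohomology of locally symmetric varieties*, Ann. of Math. 182
  (2015), §V.4 [Scholze2015].
-/

noncomputable section

open CategoryTheory

namespace Literature.NumberTheory.Automorphic

namespace ArithmeticQuotient

universe u

variable (k : Type u) [CommRing k] {Γ 𝒢 : Type u} [Group Γ] [Group 𝒢] (ι : Γ →* 𝒢)
  (L : Subgroup 𝒢) (M : Type u) [AddCommGroup M] [Module k M]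

/-- The untwisted coefficient representation is the twisted one for the trivial twist `ρ = 1`
(same underlying functions). [folklore] -/
theorem coeffRepresentation_eq_twisted (γ : Γ) :
    coeffRepresentation k ι L M γ = TwistedQuotient.coeffRepresentation ι L (1 : Representation k Γ M) γ := by
  refine LinearMap.ext fun f => funext fun c => ?_
  rw [coeffRepresentation_apply, TwistedQuotient.coeffRepresentation_apply, MonoidHom.one_apply,
    Module.End.one_apply]

/-- **`Fun(𝒢 ⧸ L, M)` untwisted `≅` twisted by the trivial representation** (identity on functions).
[folklore] -/
def coeffRepIsoTwisted : coeffRep k ι L M ≅ TwistedQuotient.coeffRep ι L (1 : Representation k Γ M) :=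
  Rep.mkIso (Representation.Equiv.mk (LinearEquiv.refl k _) fun γ => by
    rw [coeffRepresentation_eq_twisted]
    rfl)

/-- Unfolding lemma: `coeffRepIsoTwisted` is the identity on functions. [folklore] -/
@[simp]
theorem coeffRepIsoTwisted_hom_hom_apply (f : (𝒢 ⧸ L) → M) :
    (coeffRepIsoTwisted k ι L M).hom.hom f = f :=
  rfl

/-- The Hecke operators match under `coeffRepIsoTwisted` (both are `heckeFun`). [folklore] -/
theorem heckeRepHom_comp_coeffRepIsoTwisted (g : 𝒢) :
    heckeRepHom k L g M ι ≫ (coeffRepIsoTwisted k ι L M).hom =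
      (coeffRepIsoTwisted k ι L M).hom ≫ TwistedQuotient.heckeRepHom ι L (1 : Representation k Γ M) g :=
  Rep.hom_ext (Representation.IntertwiningMap.ext (LinearMap.ext fun _ => rfl))

/-- On cohomology: `H^i(coeffRepIsoTwisted) ∘ T_g = T_g ∘ H^i(coeffRepIsoTwisted)`. [folklore] -/
theorem map_coeffRepIsoTwisted_heckeEnd (g : 𝒢) (i : ℕ) (x : cohomology k ι L M i) :
    (groupCohomology.map (MonoidHom.id Γ) (coeffRepIsoTwisted k ι L M).hom i).hom
        (heckeEnd k L g M ι i x) =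
      TwistedQuotient.heckeEnd ι L (1 : Representation k Γ M) g i
        ((groupCohomology.map (MonoidHom.id Γ) (coeffRepIsoTwisted k ι L M).hom i).hom x) := by
  have h := congrArg (fun f => (groupCohomology.map (MonoidHom.id Γ) f i).hom x)
    (heckeRepHom_comp_coeffRepIsoTwisted k ι L M g)
  simp only [groupCohomology.map_id_comp, ModuleCat.hom_comp, LinearMap.comp_apply] at h
  exact h

end ArithmeticQuotient

end Literature.NumberTheory.Automorphic
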